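import Mathlib.RingTheory.Ideal.Maximal
import Literature.Computability.Cryptography.LWEPrimePowerHybrids
import HarnessLib

/-!
# Ring-LWE / Module-LWE search to decision "one prime ideal at a time": the hybrids `Aⁱ_{s,ψ}` and the guess-and-check transformation (LPR13 §5.1, Lemma 5.9; LS15 Lemma 4.18), exact laws

Topic `Computability/Cryptography` (LWE), grouping namespace `LWE.LPR13` (the discrete model of
`Literature/Computability/Cryptography/LWE.lean`: `lweSample χ s = A_{s,χ}` on `(ι → R) × R` over a
finite commutative ring `R`; Ring-LWE = rank `1`, Module-LWE = rank `d`). This file proves, EXACTLY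
and machine-free, the distributional identities behind the second arrow
`𝔮ᵢ-LWE_{q,Ψ} → WDLWEⁱ_{q,Ψ}` ("Search/Decision") of the chain of Lyubashevsky–Peikert–Regev,
*On ideal lattices and learning with errors over rings*, J. ACM 60 (2013), §5 (p. 25:
`LWE_{q,Ψ} →(5.5) 𝔮ᵢ-LWE_{q,Ψ} →(5.9) WDLWEⁱ_{q,Ψ} →(5.12) DLWEⁱ_{q,Υ} →(5.14) DLWE_{q,Υ}`), and of
its module version Langlois–Stehlé, DCC 75 (2015), §4.3, Lemma 4.18 — the mechanism by which a
distinguisher that only "sees" ONE prime ideal `𝔮ᵢ ∣ ⟨q⟩` (one CRT / NTT slot) recovers the secret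
modulo `𝔮ᵢ`. The first arrow (automorphisms, Lemma 5.5 / LS15 Lemma 4.16) is the tree's
`LWEAutomorphismInvariance.lean`.

> **Definition 5.7 (Hybrid LWE distribution)** (LPR13 p. 27). For `i ∈ ℤ*_m`, `s ∈ R_q^∨`, and a
> distribution `ψ` over `K_ℝ`, the distribution `Aⁱ_{s,ψ}` over `R_q × 𝕋` is defined as follows:
> choose `(a, b) ← A_{s,ψ}` and output `(a, b + r/q)` where `r ∈ R_q^∨` is uniformly random and
> independent mod `𝔮_j R^∨` for all `j ≤ i`, and is `0` mod all the remaining `𝔮_j R^∨`. Also define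
> `A⁰_{s,ψ}` simply as `A_{s,ψ}`.
> **Definition 5.8 (Worst-case decision LWE relative to `𝔮ᵢ`).** … `WDLWEⁱ_{q,Ψ}` …: given access
> to `Aʲ_{s,ψ}` for arbitrary `s ∈ R_q^∨`, `ψ ∈ Ψ`, and `j ∈ {i−, i}`, find `j`.
> **Lemma 5.9 (Search to Decision).** For any `i ∈ ℤ*_m`, there is a probabilistic polynomial-time
> reduction from `𝔮ᵢ-LWE_{q,Ψ}` to `WDLWEⁱ_{q,Ψ}`.
> *Proof.* The idea for recovering `s mod 𝔮ᵢR^∨` is to try each of its possible values, modifying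
> the samples we receive from `A_{s,ψ}` so that on the correct value the modified samples are
> distributed according to `A^{i−}_{s,ψ}`, whereas on all the other values the modified samples are
> distributed according to `Aⁱ_{s,ψ}`. … Because there are only `N(𝔮ᵢ) = q = poly(n)` possible
> values for `s mod 𝔮ᵢR^∨`, we can enumerate over all of them … Given a sample `(a, b) ← A_{s,ψ}`,
> the transformation produces a sample `(a', b') = (a + v, b + (r + vg)/q) ∈ R_q × 𝕋`, where
> `v ∈ R_q` is uniformly random mod `𝔮ᵢ` and is `0` mod the other `𝔮_j`, and `r ∈ R_q^∨` is
> uniformly random and independent mod `𝔮_j R^∨` for all `j < i`, and is `0` mod all the remaining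
> `𝔮_j R^∨`. First, notice that since `a` is uniformly distributed in `R_q`, so is `a'`. …
> `b' = (a's + r + v(g − s))/q + e`. … First, assume that `g = s mod 𝔮ᵢR^∨`. Then by the Chinese
> remainder theorem, `v(g − s) = 0 ∈ R_q^∨`, and hence the distribution of `(a', b')` is exactly
> `A^{i−}_{s,ψ}`. Next, assume that `g ≠ s mod 𝔮ᵢR^∨`. Then since `𝔮ᵢ` is a maximal ideal …
> `R^∨/𝔮ᵢR^∨` is a field, and hence `v(g − s)` is distributed uniformly mod `𝔮ᵢR^∨` (and is zero
> mod all other `𝔮_jR^∨`). From this it follows that `v(g − s) + r` is uniformly random and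
> independent mod `𝔮_jR^∨` for all `j ≤ i`, and is `0` mod all the remaining `𝔮_jR^∨`. Hence, the
> distribution of `(a', b')` is exactly `Aⁱ_{s,ψ}`, as promised. (LPR13 pp. 27–28.)

> **LS15 Lemma 4.18.** For any `i ∈ ℤ^×_ν`, there is a polynomial time reduction from
> `𝔮ᵢ-MLWE_{q,Ψ}` to `DecMLWEⁱ_{q,Ψ}`. *Proof.* … to find, one by one, each one of the `d`
> coordinates of `s mod 𝔮ᵢR^∨` … To find `s₁ mod 𝔮ᵢR^∨` … We construct the following pair:
> `(a', b') := (a + (y, 0, …, 0), b + (r + xy)/q)`, where `y ∈ R_q` is sampled uniformly modulo `𝔮ᵢ`,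
> and is `0` modulo all the remaining `𝔮_j`'s … if `x = s₁ mod 𝔮ᵢR^∨`, then the pair `(a', b')` is
> distributed from `A^{(M,i−)}_{q,s,ψ}` and if `x ≠ s₁ mod 𝔮ᵢR^∨`, it is distributed from
> `A^{(M,i)}_{q,s,ψ}`. … We repeat this process `d` times (once for each coordinate of `s`). (p. 21.)

## The discrete model and the CRT idempotents

As in every `LWE*.lean` file of the tree, `b` lives in `R = R_q` (normal form) rather than in the
torus `𝕋 = K_ℝ/R^∨`, and the noise law `χ` is an arbitrary `PMF R`. Write `⟨q⟩ = ∏_j 𝔮_j` with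
the `𝔮_j` pairwise comaximal (`q` unramified), so that `R_q ≅ ∏_j R/𝔮_j` (CRT) and every CRT
component is cut out by an idempotent: `e_j ∈ R_q`, `e_j ≡ 1 mod 𝔮_j`, `e_j ≡ 0 mod 𝔮_{j'}`
(`j' ≠ j`), `e_j² = e_j`, `e_j e_{j'} = 0`, `∑_j e_j = 1`, and `𝔮_j R_q = (1 − e_j) R_q`
(`mem_span_one_sub_iff`: `x ≡ 0 mod 𝔮_j ⟺ e_j x = 0`). In this language

* "`r` uniformly random and independent mod `𝔮_j` for `j ≤ i`, `0` mod the rest" is `r = f·u` with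
  `u ← U(R_q)` and `f = e_{≤ i} := ∑_{j ≤ i} e_j`, so **`Aⁱ_{s,ψ}` is the tree's
  `LWE.MP12.hybridSample χ s f`** (`(a, b + u f)`, MP12's `Aʲ` with generator `f`; `= A_{s, spread χ f}`
  by `MP12.hybridSample_eq`); `A⁰ = A_{s,χ}` is `MP12.hybridSample_zero` and the top hybrid
  (`f = ∑_j e_j = 1`) IS the uniform pair, exactly (`hybridSample_one`; on the torus this is LPR13's
  Lemma 5.13, which needs smoothing — nothing to smooth in `R_q`);
* "`v` uniformly random mod `𝔮ᵢ` and `0` mod the other `𝔮_j`" is `v = e·l`, `l ← U(R_q)`, `e = eᵢ`,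
  so the transformation of Lemma 5.9 / LS15 Lemma 4.18 on coordinate `k` with guess `g` is the tree's
  Regev coordinate test `LWE.coordSample k g (e l)` (`slotGuess`; `slotGuess_eq_coordSample`);
* "`g = s_k mod 𝔮ᵢ`" is `e g = e s_k`, and "`R/𝔮ᵢ` is a field" is `IsPrimeSlot e`
  (`∀ x, e x ≠ 0 → ∃ y, e x y = e`), which follows from the maximality of `𝔮ᵢ R_q = (1 − e)R_q`
  (`isPrimeSlot_of_isMaximal`) and holds slot by slot in any finite product of fields
  (`isPrimeSlot_single_one`; e.g. the NTT rings `T_q` of `NTTStructure.lean`).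

## Main statements (all `R` finite commutative, any rank `ι`, any noise law)

* `lweSample_bind_slotGuess` — the law of the transformed sample for a uniform `l`:
  `A_{s,χ'} ↦ A_{s, spread χ' (e (g − s_k))}`; on a hybrid: `hybridSample_bind_slotGuess`.
* **`hybridSample_bind_slotGuess_of_eq`** (correct guess `e g = e s_k`: "`v(g − s) = 0` … exactly
  `A^{i−}_{s,ψ}`") — the hybrid `f` is unchanged; `lweSample_bind_slotGuess_of_eq` (`f = 0`).
* **`hybridSample_bind_slotGuess_of_ne`** (wrong guess, `e` an idempotent with `IsPrimeSlot e`: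
  "`v(g − s)` is distributed uniformly mod `𝔮ᵢ`") — the law becomes `A_{s, spread (spread χ f) e}`,
  i.e. (`hybridSample_bind_slotGuess_of_ne'`, for `f e = 0`) EXACTLY the next hybrid
  `hybridSample χ s (f + e)`; `lweSample_bind_slotGuess_of_ne` (`f = 0`: the hybrid `e`).
* Block forms with a fresh scalar per sample (`iidPMF_pairLaw_hybrid_map_slotGuess_of_eq/_of_ne'`).
* `hybridSample_bind_shift_uniform` — Theorem 5.3's simplification of Lemma 5.12 ("modified so as
  not to randomize the error distribution, only the secret `s`"): Regev's shift by a uniform `t`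
  turns the worst-case-`s` hybrid into the uniform-secret hybrid; block form
  `hybridSamples_bind_shift_uniform(_eq)` (`= LWE.lweSamplesUniformSecret (spread χ g) m`);
  `hybridSample_bind_shift_spread_uniform` (with the printed extra uniform component).
* `abs_acceptProb_sub_le_sum_range` / `exists_le_gap_of_chain` — the hybrid (telescoping) lemma of
  Lemma 5.14 ("there must exist an `i` for which the oracle distinguishes between `Aⁱ_{s,ψ}` and
  `A^{i−}_{s,ψ}` with non-negligible advantage"), and its instance for a chain of hybrids from
  `A_{s,χ}^m` to `U^m` (`distinguishingAdvantageOf_le_sum_hybridGaps`).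
* The algebra of one slot: `mem_span_one_sub_iff` / `sub_mem_span_one_sub_iff` (the `N(𝔮ᵢ)`
  candidates are the classes of `e g`), `eq_sum_mul_of_sum_eq_one` (CRT reconstruction
  `x = ∑_j e_j x`), `isPrimeSlot_of_isMaximal`,
  `exists_unit_mul_of_isPrimeSlot` (`e x ≠ 0 ⇒ e x = w e` with `w` a unit — the form consumed by
  `MP12.spread_mul_of_isUnit`), `spread_spread_eq_spread_add`, `spread_spread_of_orthogonal`
  (`f e = 0 ⇒ spread (spread χ f) e = spread χ (f + e)`: "`v(g − s) + r` is uniformly random and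
  independent mod `𝔮_j` for all `j ≤ i`"), and the product-of-fields instance (`Pi.single i 1`).

Not here: the probabilistic bookkeeping of the reduction (majority votes over `poly` repetitions, the
enumeration loop over the `N(𝔮ᵢ)` candidates and the `d` coordinates), the Gaussian
re-randomisation of the error (Lemma 5.12 / Claim 5.11, Lemma 5.13 on `𝕋`) and hence Theorems
5.1–5.3 themselves; those are statements about continuous Gaussians `Ψ_{≤α}`/`Υ_α` on `K_ℝ`.

RELEVANCE (PQC-structure census, strand (c) DISTINGUISHERS / T-ALG slot statistics): a test that
tells `A^{i−}` from `Aⁱ` for ONE slot `𝔮ᵢ` — i.e. detects whether the `𝔮ᵢ`-component of `b − a·g`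
is noise or uniform — IS, up to `d · N(𝔮ᵢ)` oracle calls, key recovery modulo `𝔮ᵢ` (this file), hence
modulo every `𝔮_j` (automorphisms, `LWEAutomorphismInvariance.lean`), hence of `s` (CRT).

## References

* V. Lyubashevsky, C. Peikert, O. Regev, *On ideal lattices and learning with errors over rings*,
  J. ACM 60 (2013), art. 43, §5 (pp. 25–30): Def. 5.4, Lemma 5.5, Def. 5.7, Def. 5.8, Lemma 5.9
  (with proof, pp. 27–28), Lemma 5.12, Lemma 5.13, Lemma 5.14, Thm. 5.3 (read: held
  `paper:doi-10-1145-2535925`, p0025–p0030). [LyubashevskyPeikertRegev2013JACM]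
* A. Langlois, D. Stehlé, *Worst-case to average-case reductions for module lattices*, Des. Codes
  Cryptogr. 75 (2015) 565–599, §4.3: hybrid `A^{(M,i)}`, `𝔮ᵢ-MLWE`, `DecMLWEⁱ`, Lemma 4.18 with
  proof (read: held `paper:roux-langlois2014-…-module-lattices`, p0020–p0021). [LangloisStehle2014]
* D. Micciancio, C. Peikert, *Trapdoors for lattices*, EUROCRYPT 2012, Thm. 3.1 (the hybrids `Aʲ` as
  "`b + r·g`", tree file `LWEPrimePowerHybrids.lean`: `MP12.spread`, `MP12.hybridSample`).
  [MicciancioPeikert2012]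
* O. Regev, *On lattices, learning with errors, …*, J. ACM 56 (2009), §4, Lemma 4.2 (the coordinate
  test "`(a + (l, 0, …, 0), b + l·k)`", tree file `LWERegevTransforms.lean`: `coordSample`) — LS15:
  "we use the same approach as in [36, Le. 4.2] and randomize a coordinate of `a`". [RegevLWE2009]
-/

noncomputable section

open scoped ENNReal

namespace Literature.Computability.Cryptography

namespace LWE

namespace LPR13

open MP12

/-! ### Complements to the `spread` calculus: two generators -/

section Spread

variable {R : Type} [CommRing R] [Fintype R]

/-- The sign of a generator is immaterial: `spread χ (−g) = spread χ g` (a unit factor;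
LPR13 / LS15 write `+ vg`, MP12 `− r'…`). [cite: MicciancioPeikert2012, Thm. 3.1 proof (p. 15)] -/
theorem spread_neg (χ : PMF R) (g : R) : spread χ (-g) = spread χ g := by
  rw [show -g = (-1 : R) * g by ring]
  exact spread_mul_of_isUnit χ isUnit_one.neg g

/-- **Two spreads, reindexed**: the law of `e' + u f + u' e` (`u, u'` uniform, independent) is also the
law of `e' + u (f + e) + u'' e` (substitute `u'' = u' − u`, again uniform and independent of `u`):
`spread (spread χ f) e = spread (spread χ (f + e)) e`. [cite: LyubashevskyPeikertRegev2013JACM, Lemma 5.9 proof (p. 28: "`v(g − s) + r` is uniformly random and independent mod `𝔮_j R^∨` for all `j ≤ i`")] -/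
theorem spread_spread_eq_spread_add (χ : PMF R) (f e : R) :
    spread (spread χ f) e = spread (spread χ (f + e)) e := by
  ext x
  rw [spread_apply, spread_apply]
  congr 1
  simp_rw [spread_apply, Finset.mul_sum]
  rw [Finset.sum_comm]
  conv_rhs => rw [Finset.sum_comm]
  refine Finset.sum_congr rfl fun u _ => ?_
  have hbij : Function.Bijective fun r : R => r - u :=
    (Finite.injective_iff_bijective).1 (sub_left_injective)
  exact Fintype.sum_bijective _ hbij
    (fun r => (Fintype.card R : ℝ≥0∞)⁻¹ * χ (x - r * e - u * f))
    (fun r => (Fintype.card R : ℝ≥0∞)⁻¹ * χ (x - r * e - u * (f + e)))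
    fun r => by
      show (Fintype.card R : ℝ≥0∞)⁻¹ * χ (x - r * e - u * f) =
        (Fintype.card R : ℝ≥0∞)⁻¹ * χ (x - (r - u) * e - u * (f + e))
      congr 2
      ring

/-- **Absorption for orthogonal idempotent generators**: if `e` is idempotent and `f e = 0` then
spreading along `f` and then along `e` is spreading along `f + e`:
`spread (spread χ f) e = spread χ (f + e)` — "`v(g − s) + r` is uniformly random and independent
mod `𝔮_j R^∨` for all `j ≤ i`, and is `0` mod all the remaining `𝔮_j R^∨`", i.e. the hybrid `i−`
plus a uniform `𝔮ᵢ`-component is the hybrid `i`. [cite: LyubashevskyPeikertRegev2013JACM, Lemma 5.9 proof (p. 28)] -/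
theorem spread_spread_of_orthogonal (χ : PMF R) {f e : R} (he : IsIdempotentElem e)
    (hfe : f * e = 0) : spread (spread χ f) e = spread χ (f + e) := by
  rw [spread_spread_eq_spread_add]
  refine spread_spread_of_dvd χ ⟨e, ?_⟩
  rw [add_mul, hfe, he.eq, zero_add]

end Spread

/-! ### The algebra of one CRT slot: the idempotent `e = eᵢ` of `𝔮ᵢ` -/

section Slot

variable {R : Type} [CommRing R]

/-- **CRT dictionary**: for an idempotent `e`, membership in the ideal `(1 − e)` (`= 𝔮ᵢ R_q` when
`e = eᵢ`) is the vanishing of the `e`-component: `x ∈ (1 − e) ⟺ e x = 0`. So "`g = s mod 𝔮ᵢ`" reads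
`e g = e s`. [cite: LyubashevskyPeikertRegev2013JACM, Lemma 2.12 (CRT) and Lemma 5.9 proof (p. 28: "by the Chinese remainder theorem, `v(g − s) = 0`")] -/
theorem mem_span_one_sub_iff {e : R} (he : IsIdempotentElem e) (x : R) :
    x ∈ Ideal.span {1 - e} ↔ e * x = 0 := by
  rw [Ideal.mem_span_singleton']
  constructor
  · rintro ⟨a, rfl⟩
    rw [mul_comm a, ← mul_assoc, mul_sub, mul_one, he.eq, sub_self, zero_mul]
  · intro h
    exact ⟨x, by rw [mul_sub, mul_one, mul_comm x e, h, sub_zero]⟩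

/-- "`R/𝔮ᵢ` is a field", said on the slot `e R ≅ R/(1 − e)`: every nonzero element `e x` of the slot
is invertible inside the slot (`∃ y, (e x) y = e`, `e` being the `1` of the corner ring `e R`). For
Ring-LWE / Module-LWE with `q` unramified this holds for every CRT idempotent `eᵢ` because `𝔮ᵢ` is
maximal (`isPrimeSlot_of_isMaximal`). [cite: LyubashevskyPeikertRegev2013JACM, Lemma 5.9 proof (p. 28: "since `𝔮ᵢ` is a maximal ideal …, `R^∨/𝔮ᵢR^∨` is a field")] -/
def IsPrimeSlot (e : R) : Prop := ∀ x : R, e * x ≠ 0 → ∃ y : R, e * x * y = e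

/-- **Maximality of `𝔮ᵢ = (1 − e)` makes the slot a field**: if `e` is idempotent and `(1 − e)` is a
maximal ideal then `IsPrimeSlot e`. (From `Ideal.IsMaximal.exists_inv`: `x ∉ (1 − e)` gives
`y x + i = 1` with `i ∈ (1 − e)`, and multiplying by `e` kills `i`.) [cite: LyubashevskyPeikertRegev2013JACM, Lemma 5.9 proof (p. 28)] -/
theorem isPrimeSlot_of_isMaximal {e : R} (he : IsIdempotentElem e)
    (hmax : (Ideal.span {1 - e}).IsMaximal) : IsPrimeSlot e := by
  intro x hx
  have hxnot : x ∉ Ideal.span {1 - e} := fun h => hx ((mem_span_one_sub_iff he x).1 h)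
  obtain ⟨y, i, hi, hyi⟩ := hmax.exists_inv hxnot
  have hei : e * i = 0 := (mem_span_one_sub_iff he i).1 hi
  refine ⟨y, ?_⟩
  calc e * x * y = e * (y * x + i) - e * i := by ring
    _ = e := by rw [hyi, hei, mul_one, sub_zero]

/-- **A nonzero slot element is a unit multiple of the slot idempotent**: for `e` idempotent with
`IsPrimeSlot e` and `e x ≠ 0` there is a unit `w` of `R` with `e x = w e` (take `w = e x + (1 − e)`,
inverse `e y + (1 − e)`). This is the form in which "`v(g − s)` is distributed uniformly mod `𝔮ᵢ`"
enters the `spread` calculus (`MP12.spread_mul_of_isUnit`). [cite: LyubashevskyPeikertRegev2013JACM, Lemma 5.9 proof (p. 28)] -/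
theorem exists_unit_mul_of_isPrimeSlot {e : R} (he : IsIdempotentElem e) (hfield : IsPrimeSlot e)
    {x : R} (hx : e * x ≠ 0) : ∃ w : R, IsUnit w ∧ e * x = w * e := by
  obtain ⟨y, hy⟩ := hfield x hx
  have h2 : e * e = e := he.eq
  refine ⟨e * x + (1 - e), ?_, ?_⟩
  · refine IsUnit.of_mul_eq_one (e * y + (1 - e)) ?_
    linear_combination (x * y - x - y + 1) * h2 + hy
  · linear_combination (1 - x) * h2

/-- **CRT reconstruction** ("We can then efficiently reconstruct `s ∈ R_q^∨` using the Chinese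
remainder theorem", proof of Lemma 5.5): for a complete system `∑_j e_j = 1` an element is the sum of
its slot components, `x = ∑_j e_j x` — so the values `e_j s_k` for all `j` (each found by the
guess-and-check below, after transport by the automorphisms) determine `s`. [cite: LyubashevskyPeikertRegev2013JACM, Lemma 5.5 (proof, p. 26) and Lemma 2.12 (CRT)] -/
theorem eq_sum_mul_of_sum_eq_one {κ : Type} (t : Finset κ) {e : κ → R} (h : ∑ j ∈ t, e j = 1)
    (x : R) : x = ∑ j ∈ t, e j * x := by
  rw [← Finset.sum_mul, h, one_mul]

/-- Two candidates with the same slot value are the same guess: the ideal `(1 − e)` has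
`x − x' ∈ (1 − e) ⟺ e x = e x'` (so the candidates `g` of Lemma 5.9 are the `N(𝔮ᵢ) = |R/𝔮ᵢ|` classes
of `R` modulo `𝔮ᵢ`, and the laws below depend on `g` only through `e g`). [cite: LyubashevskyPeikertRegev2013JACM, Lemma 5.9 (proof, p. 27: "only `N(𝔮ᵢ) = q = poly(n)` possible values for `s mod 𝔮ᵢR^∨`")] -/
theorem sub_mem_span_one_sub_iff {e : R} (he : IsIdempotentElem e) (x x' : R) :
    x - x' ∈ Ideal.span {1 - e} ↔ e * x = e * x' := by
  rw [mem_span_one_sub_iff he, mul_sub, sub_eq_zero]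

/-- `IsPrimeSlot` is transported along ring isomorphisms (so it can be read off a CRT / NTT
decomposition `R_q ≃+* ∏_j F_j`). [cite: LyubashevskyPeikertRegev2013JACM, §2.3.3 / Lemma 2.12 (CRT isomorphism)] -/
theorem IsPrimeSlot.of_ringEquiv {S : Type} [CommRing S] (φ : R ≃+* S) {e : R}
    (h : IsPrimeSlot (φ e)) : IsPrimeSlot e := by
  intro x hx
  have hx' : φ e * φ x ≠ 0 := by
    rw [← map_mul]
    exact fun h0 => hx (by simpa using congrArg φ.symm h0)
  obtain ⟨y', hy'⟩ := h (φ x) hx'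
  refine ⟨φ.symm y', φ.injective ?_⟩
  rw [map_mul, map_mul, RingEquiv.apply_symm_apply, hy']

end Slot

/-! ### The slots of a finite product of fields (`R_q ≅ ∏_j R/𝔮_j`, the NTT domain `T_q`) -/

section ProductOfFields

variable {κ : Type} [DecidableEq κ] {F : κ → Type} [∀ j, Field (F j)]

/-- The standard idempotents `e_j = (0, …, 1, …, 0)` of a product of fields are idempotent. [cite: LyubashevskyPeikertRegev2013JACM, Lemma 2.12 (CRT: `R_q ≅ ⊕_i R/𝔮_i`)] -/
theorem isIdempotentElem_single_one (j : κ) :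
    IsIdempotentElem (Pi.single j (1 : F j) : ∀ l, F l) := by
  rw [IsIdempotentElem, ← Pi.single_mul, mul_one]

/-- … pairwise orthogonal. [cite: LyubashevskyPeikertRegev2013JACM, Lemma 2.12 (CRT)] -/
theorem single_one_mul_single_one_of_ne {j j' : κ} (h : j ≠ j') :
    (Pi.single j (1 : F j) : ∀ l, F l) * Pi.single j' 1 = 0 := by
  funext l
  rw [Pi.mul_apply, Pi.zero_apply]
  by_cases hl : l = j
  · subst hl
    rw [Pi.single_eq_of_ne h, mul_zero]
  · rw [Pi.single_eq_of_ne hl, zero_mul]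

/-- … sum to `1` (over a finite index set). [cite: LyubashevskyPeikertRegev2013JACM, Lemma 2.12 (CRT)] -/
theorem sum_single_one [Fintype κ] : ∑ j, (Pi.single j (1 : F j) : ∀ l, F l) = 1 :=
  Finset.univ_sum_single (1 : ∀ l, F l)

/-- … and each slot is a field: `IsPrimeSlot (Pi.single j 1)` ("`R^∨/𝔮ᵢR^∨` is a field"). [cite: LyubashevskyPeikertRegev2013JACM, Lemma 5.9 proof (p. 28)] -/
theorem isPrimeSlot_single_one (j : κ) : IsPrimeSlot (Pi.single j (1 : F j) : ∀ l, F l) := by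
  intro x hx
  have hxj : x j ≠ 0 := by
    intro h0
    apply hx
    funext l
    rw [Pi.mul_apply, Pi.zero_apply]
    by_cases hl : l = j
    · subst hl
      rw [h0, mul_zero]
    · rw [Pi.single_eq_of_ne hl, zero_mul]
  refine ⟨Pi.single j (x j)⁻¹, funext fun l => ?_⟩
  rw [Pi.mul_apply, Pi.mul_apply]
  by_cases hl : l = j
  · subst hl
    rw [Pi.single_eq_same, Pi.single_eq_same, one_mul, mul_inv_cancel₀ hxj]
  · rw [Pi.single_eq_of_ne hl, zero_mul, zero_mul]

end ProductOfFields

/-! ### The hybrids `Aⁱ_{s,χ}` and the guess-and-check transformation -/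

section SlotGuess

variable {ι : Type} [Fintype ι] [DecidableEq ι]
variable {R : Type} [CommRing R] [Fintype R]

/-- **The top hybrid is the uniform pair, exactly**: with the generator `1 = ∑_j e_j` (all slots
randomised) `hybridSample χ s 1 = U(R^ι × R)` (LPR13 Lemma 5.13: on the torus `A^{m−1}_{s,ψ}` is only
`ε/2`-close to uniform; in `R_q` there is nothing to smooth). [cite: LyubashevskyPeikertRegev2013JACM, Lemma 5.13 (p. 29)] -/
theorem hybridSample_one (χ : PMF R) (s : ι → R) :
    hybridSample χ s 1 = PMF.uniformOfFintype ((ι → R) × R) :=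
  hybridSample_of_isUnit χ s isUnit_one

/-- **The transformation of Lemma 5.9 / LS15 Lemma 4.18** on coordinate `k` of the secret, with slot
idempotent `e`, candidate value `g` and scalar `l`: `(a, b) ↦ (a + (e l)·1_k, b + (e l)·g)` —
"`(a', b') := (a + (y, 0, …, 0), b + (r + x y)/q)` where `y ∈ R_q` is sampled uniformly modulo
`𝔮ᵢ`, and is `0` modulo all the remaining `𝔮_j`'s" with `y = e l` (the `r`-part is the passage to
the input hybrid, see `hybridSample_bind_slotGuess`). It is Regev's coordinate test
`coordSample k g (e l)`. [cite: LangloisStehle2014, Lemma 4.18 (proof); LyubashevskyPeikertRegev2013JACM, Lemma 5.9 (proof, p. 27: "`(a', b') = (a + v, b + (r + vg)/q)`")] -/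
def slotGuess (e : R) (k : ι) (g l : R) : (ι → R) × R → (ι → R) × R :=
  coordSample k g (e * l)

omit [Fintype ι] [Fintype R] in
/-- `slotGuess` IS the tree's `coordSample` with the scalar restricted to the slot. [cite: LangloisStehle2014, Lemma 4.18 (proof: "we use the same approach as in [36, Le. 4.2]")] -/
theorem slotGuess_eq_coordSample (e : R) (k : ι) (g l : R) :
    slotGuess e k g l = coordSample k g (e * l) := rfl

omit [Fintype ι] [Fintype R] in
/-- Unfolding lemma. [cite: LangloisStehle2014, Lemma 4.18 (proof)] -/
@[simp] theorem slotGuess_apply (e : R) (k : ι) (g l : R) (a : ι → R) (b : R) :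
    slotGuess e k g l (a, b) = (a + Pi.single k (e * l), b + e * l * g) := rfl

/-- **Law of the transformed sample** for a uniform scalar `l`: `(a, b) ← A_{s,χ'}` is sent to
`A_{s, spread χ' (e (g − s_k))}` — "`b' = ⟨a', s⟩ + e + (r + y(x − s₁))/q`" with `a'` again uniform
and `y (x − s₁) = l · e (g − s_k)` spreading the noise along `e (g − s_k)`. [cite: LangloisStehle2014, Lemma 4.18 (proof); LyubashevskyPeikertRegev2013JACM, Lemma 5.9 (proof, p. 28: "`b' = (a's + r + v(g − s))/q + e`")] -/
theorem lweSample_bind_slotGuess (χ' : PMF R) (s : ι → R) (e : R) (k : ι) (g : R) :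
    ((PMF.uniformOfFintype R).bind fun l => (lweSample χ' s).map (slotGuess e k g l)) =
      lweSample (spread χ' (e * (g - s k))) s := by
  ext ⟨a, b⟩
  rw [PMF.bind_apply, tsum_fintype, lweSample_mass, spread_apply]
  simp_rw [PMF.uniformOfFintype_apply, slotGuess_eq_coordSample, lweSample_map_coordSample_apply]
  rw [Finset.mul_sum, Finset.mul_sum]
  refine Finset.sum_congr rfl fun l _ => ?_
  rw [show b - a ⬝ᵥ s - e * l * (g - s k) = b - a ⬝ᵥ s - l * (e * (g - s k)) by ring]
  ring

/-- The transformation on the hybrid `f` (`Aⁱ⁻`, generator `f = e_{<i}`; the input `A_{s,χ}` of the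
reduction is `f = 0`, and adding "`r` uniformly random and independent mod `𝔮_j`, `j < i`" is the
passage `A_{s,χ} ↦ A^{i−}_{s,χ}`): the law becomes `A_{s, spread (spread χ f) (e (g − s_k))}`. [cite: LyubashevskyPeikertRegev2013JACM, Lemma 5.9 (proof, pp. 27–28); LangloisStehle2014, Lemma 4.18 (proof)] -/
theorem hybridSample_bind_slotGuess (χ : PMF R) (s : ι → R) (f e : R) (k : ι) (g : R) :
    ((PMF.uniformOfFintype R).bind fun l => (hybridSample χ s f).map (slotGuess e k g l)) =
      lweSample (spread (spread χ f) (e * (g - s k))) s := by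
  rw [hybridSample_eq, lweSample_bind_slotGuess]

/-- **Lemma 5.9 / LS15 Lemma 4.18, first case — correct guess.** If `g = s_k mod 𝔮ᵢ`, i.e.
`e g = e s_k`, then "`v(g − s) = 0` … and hence the distribution of `(a', b')` is exactly
`A^{i−}_{s,ψ}`": the hybrid `f` is mapped to itself. (No hypothesis on `e`.) [cite: LyubashevskyPeikertRegev2013JACM, Lemma 5.9 (proof, p. 28, first case); LangloisStehle2014, Lemma 4.18 (proof, first case)] -/
theorem hybridSample_bind_slotGuess_of_eq (χ : PMF R) (s : ι → R) (f : R) {e : R} {k : ι} {g : R}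
    (hg : e * g = e * s k) :
    ((PMF.uniformOfFintype R).bind fun l => (hybridSample χ s f).map (slotGuess e k g l)) =
      hybridSample χ s f := by
  rw [hybridSample_bind_slotGuess, show e * (g - s k) = 0 by rw [mul_sub, hg, sub_self], spread_zero,
    hybridSample_eq]

/-- **Lemma 5.9 / LS15 Lemma 4.18, second case — wrong guess** (general form). If `e` is an
idempotent whose slot is a field (`IsPrimeSlot e`: "`𝔮ᵢ` is a maximal ideal") and `e g ≠ e s_k`, then
"`v(g − s)` is distributed uniformly mod `𝔮ᵢR^∨` (and is zero mod all other `𝔮_jR^∨`)": the hybrid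
`f` is mapped to `A_{s, spread (spread χ f) e}` — the law with an extra independent uniform
`e`-component. [cite: LyubashevskyPeikertRegev2013JACM, Lemma 5.9 (proof, p. 28, second case); LangloisStehle2014, Lemma 4.18 (proof, second case)] -/
theorem hybridSample_bind_slotGuess_of_ne (χ : PMF R) (s : ι → R) (f : R) {e : R}
    (he : IsIdempotentElem e) (hfield : IsPrimeSlot e) {k : ι} {g : R} (hg : e * g ≠ e * s k) :
    ((PMF.uniformOfFintype R).bind fun l => (hybridSample χ s f).map (slotGuess e k g l)) =
      lweSample (spread (spread χ f) e) s := by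
  have hx : e * (g - s k) ≠ 0 := by rwa [mul_sub, sub_ne_zero]
  obtain ⟨w, hw, hwe⟩ := exists_unit_mul_of_isPrimeSlot he hfield hx
  rw [hybridSample_bind_slotGuess, hwe, spread_mul_of_isUnit _ hw]

/-- **Lemma 5.9 / LS15 Lemma 4.18, second case — wrong guess, as printed.** With `f = e_{<i}`
orthogonal to `e = eᵢ` (`f e = 0`): "`v(g − s) + r` is uniformly random and independent mod `𝔮_jR^∨`
for all `j ≤ i`, and is `0` mod all the remaining `𝔮_jR^∨`. Hence, the distribution of `(a', b')`
is exactly `Aⁱ_{s,ψ}`" — the hybrid `f` is mapped to the hybrid `f + e` (`= e_{≤ i}`). [cite: LyubashevskyPeikertRegev2013JACM, Lemma 5.9 (proof, p. 28, second case); LangloisStehle2014, Lemma 4.18 (proof, second case)] -/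
theorem hybridSample_bind_slotGuess_of_ne' (χ : PMF R) (s : ι → R) {f e : R}
    (he : IsIdempotentElem e) (hfield : IsPrimeSlot e) (hfe : f * e = 0) {k : ι} {g : R}
    (hg : e * g ≠ e * s k) :
    ((PMF.uniformOfFintype R).bind fun l => (hybridSample χ s f).map (slotGuess e k g l)) =
      hybridSample χ s (f + e) := by
  rw [hybridSample_bind_slotGuess_of_ne χ s f he hfield hg, spread_spread_of_orthogonal χ he hfe,
    hybridSample_eq]

/-- The reduction's own input is `A_{s,χ} = A⁰`: with a correct guess the transformed `A_{s,χ}`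
(no `r` added, `f = 0`) is `A_{s,χ}` again. [cite: LyubashevskyPeikertRegev2013JACM, Lemma 5.9 (proof, first case) and Def. 5.7 ("`A⁰_{s,ψ}` simply as `A_{s,ψ}`")] -/
theorem lweSample_bind_slotGuess_of_eq (χ : PMF R) (s : ι → R) {e : R} {k : ι} {g : R}
    (hg : e * g = e * s k) :
    ((PMF.uniformOfFintype R).bind fun l => (lweSample χ s).map (slotGuess e k g l)) =
      lweSample χ s := by
  rw [← hybridSample_zero, hybridSample_bind_slotGuess_of_eq χ s 0 hg]

/-- … and with a wrong guess it is the first hybrid `hybridSample χ s e` (for `i` the least index: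
`A^{1}_{s,ψ}`, uniform on the slot `𝔮ᵢ` only). [cite: LyubashevskyPeikertRegev2013JACM, Lemma 5.9 (proof, second case); LangloisStehle2014, Lemma 4.18] -/
theorem lweSample_bind_slotGuess_of_ne (χ : PMF R) (s : ι → R) {e : R} (he : IsIdempotentElem e)
    (hfield : IsPrimeSlot e) {k : ι} {g : R} (hg : e * g ≠ e * s k) :
    ((PMF.uniformOfFintype R).bind fun l => (lweSample χ s).map (slotGuess e k g l)) =
      hybridSample χ s e := by
  rw [← hybridSample_zero, hybridSample_bind_slotGuess_of_ne' χ s he hfield (zero_mul e) hg, zero_add]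

/-- **The dichotomy decides `s_k mod 𝔮ᵢ`**: for an idempotent field slot `e` orthogonal to `f`, the
transformed law is the hybrid `f` if `e g = e s_k` and the hybrid `f + e` otherwise — so an oracle
telling the two hybrids apart ("find `j ∈ {i−, i}`", Def. 5.8) answers whether the guess `g` is
right, and enumerating the `N(𝔮ᵢ)` values of `e g` finds `e s_k` ("Because there are only
`N(𝔮ᵢ) = q = poly(n)` possible values … we can enumerate over all of them"). [cite: LyubashevskyPeikertRegev2013JACM, Def. 5.8 and Lemma 5.9 (proof, p. 27); LangloisStehle2014, Lemma 4.18 ("For each coordinate, there are `N(𝔮ᵢ) = q ≤ poly(n)` possibilities")] -/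
theorem hybridSample_bind_slotGuess_eq_ite (χ : PMF R) (s : ι → R) {f e : R}
    (he : IsIdempotentElem e) (hfield : IsPrimeSlot e) (hfe : f * e = 0) (k : ι) (g : R)
    [Decidable (e * g = e * s k)] :
    ((PMF.uniformOfFintype R).bind fun l => (hybridSample χ s f).map (slotGuess e k g l)) =
      if e * g = e * s k then hybridSample χ s f else hybridSample χ s (f + e) := by
  split_ifs with hg
  · exact hybridSample_bind_slotGuess_of_eq χ s f hg
  · exact hybridSample_bind_slotGuess_of_ne' χ s he hfield hfe hg

/-! #### Block forms: `m` samples, a fresh scalar for each -/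

/-- **Block form, correct guess**: transforming every sample of `(U_R ⊗ A^f_{s,χ})^{⊗m}` with its own
scalar gives the block `(A^f_{s,χ})^m`. [cite: LyubashevskyPeikertRegev2013JACM, Lemma 5.9 (proof: "modifying the samples we receive"); LangloisStehle2014, Lemma 4.18] -/
theorem iidPMF_pairLaw_hybrid_map_slotGuess_of_eq (χ : PMF R) (s : ι → R) (f : R) {e : R} {k : ι}
    {g : R} (hg : e * g = e * s k) (m : ℕ) :
    (iidPMF (pairLaw (hybridSample χ s f)) m).map (fun x => (fun y => slotGuess e k g y.1 y.2) ∘ x) =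
      hybridSamples χ s f m := by
  rw [iidPMF_map, pairLaw_map_apply₂, hybridSample_bind_slotGuess_of_eq χ s f hg,
    hybridSamples_eq_iidPMF]

/-- **Block form, wrong guess**: the transformed block is `(A^{f+e}_{s,χ})^m`. [cite: LyubashevskyPeikertRegev2013JACM, Lemma 5.9 (proof); LangloisStehle2014, Lemma 4.18] -/
theorem iidPMF_pairLaw_hybrid_map_slotGuess_of_ne' (χ : PMF R) (s : ι → R) {f e : R}
    (he : IsIdempotentElem e) (hfield : IsPrimeSlot e) (hfe : f * e = 0) {k : ι} {g : R}
    (hg : e * g ≠ e * s k) (m : ℕ) :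
    (iidPMF (pairLaw (hybridSample χ s f)) m).map (fun x => (fun y => slotGuess e k g y.1 y.2) ∘ x) =
      hybridSamples χ s (f + e) m := by
  rw [iidPMF_map, pairLaw_map_apply₂, hybridSample_bind_slotGuess_of_ne' χ s he hfield hfe hg,
    hybridSamples_eq_iidPMF]

/-! #### Randomising the secret (the simplification of Lemma 5.12 used for Theorem 5.3) -/

/-- **Worst-case secret to uniformly random secret, on a hybrid**: Regev's shift
`(a, b) ↦ (a, b + ⟨a, t⟩)` by a uniform `t` sends the hybrid of ANY fixed `s` to the hybrid of a
uniformly random secret — "Lemma 5.12 is modified so as not to randomize the error distribution,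
only the secret `s`" (the transformation "mapping each `(a, b)` to `(a, b + (a·s' + r)/q + e')`"
with `e' = 0`: it "maps `Aⁱ_{s,ψ}` to `A^{max{i,k}}_{s+s',ψ}`"). [cite: LyubashevskyPeikertRegev2013JACM, Lemma 5.12 (proof, p. 29) and Theorem 5.3 (p. 26)] -/
theorem hybridSample_bind_shift_uniform (χ : PMF R) (s : ι → R) (g : R) :
    ((PMF.uniformOfFintype (ι → R)).bind fun t => (hybridSample χ s g).map (shiftSample t)) =
      (PMF.uniformOfFintype (ι → R)).bind fun s' => hybridSample χ s' g := by
  simp_rw [hybridSample_map_shiftSample]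
  have hbij : Function.Bijective fun t : ι → R => s + t :=
    ⟨add_right_injective s, fun u => ⟨u - s, add_sub_cancel s u⟩⟩
  conv_rhs => rw [← uniformOfFintype_map_of_bijective hbij, PMF.bind_map]
  rfl

/-- Block form: shifting all `m` samples of the hybrid block of a fixed `s` by one uniform `t` gives
the hybrid block of a uniformly random secret (the uniform-secret branch of the tree's decision
experiment, `LWE.lweSamplesUniformSecret`, for the hybrid noise `spread χ g`). [cite: LyubashevskyPeikertRegev2013JACM, Lemma 5.12 (proof, p. 29) and Theorem 5.3 (p. 26)] -/
theorem hybridSamples_bind_shift_uniform (χ : PMF R) (s : ι → R) (g : R) (m : ℕ) :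
    ((PMF.uniformOfFintype (ι → R)).bind fun t =>
        (hybridSamples χ s g m).map fun v => shiftSample t ∘ v) =
      (PMF.uniformOfFintype (ι → R)).bind fun s' => hybridSamples χ s' g m := by
  simp_rw [hybridSamples_map_shift]
  have hbij : Function.Bijective fun t : ι → R => s + t :=
    ⟨add_right_injective s, fun u => ⟨u - s, add_sub_cancel s u⟩⟩
  conv_rhs => rw [← uniformOfFintype_map_of_bijective hbij, PMF.bind_map]
  rfl

/-- … which IS the uniform-secret LWE block for the spread noise: `= lweSamplesUniformSecret (spread χ g) m`. [cite: LyubashevskyPeikertRegev2013JACM, Theorem 5.3 (p. 26: "use error distribution `D_α` in all the average-case problems")] -/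
theorem hybridSamples_bind_shift_uniform_eq (χ : PMF R) (s : ι → R) (g : R) (m : ℕ) :
    ((PMF.uniformOfFintype (ι → R)).bind fun t =>
        (hybridSamples χ s g m).map fun v => shiftSample t ∘ v) =
      lweSamplesUniformSecret (spread χ g) m := by
  rw [hybridSamples_bind_shift_uniform]
  rfl

/-- The same with the extra uniform component of the printed transformation (`r` uniform mod `𝔮_j`,
`j ≤ k`, realised as `u·g'`): shifting the secret and spreading along `g'` sends the hybrid `g` of a
fixed `s` to `A_{s', spread (spread χ g) g'}` for a uniform `s'` (for `g ∣ g'` resp. `g' ∣ g` this is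
the hybrid `g` resp. `g'`: `MP12.spread_spread_of_dvd/'`, i.e. "`A^{max{i,k}}`"). [cite: LyubashevskyPeikertRegev2013JACM, Lemma 5.12 (proof, p. 29: "this transformation maps `Aⁱ_{s,ψ}` to `A^{max{i,k}}_{s+s',ψ+D_{r'}}`")] -/
theorem hybridSample_bind_shift_spread_uniform (χ : PMF R) (s : ι → R) (g g' : R) :
    ((PMF.uniformOfFintype (ι → R)).bind fun t => (PMF.uniformOfFintype R).bind fun u =>
        (hybridSample χ s g).map fun x => shiftSample t (x.1, x.2 + u * g')) =
      (PMF.uniformOfFintype (ι → R)).bind fun s' => lweSample (spread (spread χ g) g') s' := by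
  have hinner : ∀ t : ι → R,
      ((PMF.uniformOfFintype R).bind fun u =>
          (hybridSample χ s g).map fun x => shiftSample t (x.1, x.2 + u * g')) =
        lweSample (spread (spread χ g) g') (s + t) := by
    intro t
    have hsplit : ∀ u : R,
        ((hybridSample χ s g).map fun x => shiftSample t (x.1, x.2 + u * g')) =
          ((hybridSample χ s g).map fun x : (ι → R) × R => (x.1, x.2 + u * g')).map
            (shiftSample t) := by
      intro u
      rw [PMF.map_comp]
      rfl
    simp_rw [hsplit, hybridSample_eq]
    rw [← PMF.map_bind]
    · have h2 : ((PMF.uniformOfFintype R).bind fun u =>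
          (lweSample (spread χ g) s).map fun x : (ι → R) × R => (x.1, x.2 + u * g')) =
          lweSample (spread (spread χ g) g') s := by
        rw [← hybridSample_eq (spread χ g) s g']
        rfl
      rw [h2, lweSample_map_shiftSample]
  simp_rw [hinner]
  have hbij : Function.Bijective fun t : ι → R => s + t :=
    ⟨add_right_injective s, fun u => ⟨u - s, add_sub_cancel s u⟩⟩
  conv_rhs => rw [← uniformOfFintype_map_of_bijective hbij, PMF.bind_map]
  rfl

end SlotGuess

/-! ### The hybrid lemma (Lemma 5.14): some consecutive pair of hybrids is distinguished -/

section Telescoping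

variable {β : Type}

/-- **Telescoping** for acceptance probabilities along a chain `H₀, H₁, …, H_N`:
`|Pr[D(H₀)] − Pr[D(H_N)]| ≤ ∑_{i<N} |Pr[D(Hᵢ)] − Pr[D(Hᵢ₊₁)]|` ("We use a simple hybrid
argument"). [cite: LyubashevskyPeikertRegev2013JACM, Lemma 5.14 (proof, p. 30)] -/
theorem abs_acceptProb_sub_le_sum_range (D : β → PMF Bool) (H : ℕ → PMF β) (N : ℕ) :
    |(acceptProb D (H 0)).toReal - (acceptProb D (H N)).toReal| ≤
      ∑ i ∈ Finset.range N,
        |(acceptProb D (H i)).toReal - (acceptProb D (H (i + 1))).toReal| := by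
  have htel : (acceptProb D (H 0)).toReal - (acceptProb D (H N)).toReal =
      ∑ i ∈ Finset.range N,
        ((acceptProb D (H i)).toReal - (acceptProb D (H (i + 1))).toReal) := by
    rw [Finset.sum_range_sub' (fun i => (acceptProb D (H i)).toReal) N]
  rw [htel]
  exact Finset.abs_sum_le_sum_abs _ _

/-- **Lemma 5.14's pigeonhole**: along a chain of `N ≥ 1` hybrids some consecutive pair carries at
least a `1/N` fraction of the end-to-end gap: `∃ i < N, |Pr[D(H₀)] − Pr[D(H_N)]| / N ≤
|Pr[D(Hᵢ)] − Pr[D(Hᵢ₊₁)]|` ("there must exist an `i ∈ ℤ*_m` for which the oracle distinguishes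
between `Aⁱ_{s,ψ}` and `A^{i−}_{s,ψ}` with non-negligible advantage"). [cite: LyubashevskyPeikertRegev2013JACM, Lemma 5.14 (proof, p. 30)] -/
theorem exists_le_gap_of_chain (D : β → PMF Bool) (H : ℕ → PMF β) {N : ℕ} (hN : 0 < N) :
    ∃ i < N, |(acceptProb D (H 0)).toReal - (acceptProb D (H N)).toReal| / N ≤
      |(acceptProb D (H i)).toReal - (acceptProb D (H (i + 1))).toReal| := by
  have hne : (Finset.range N).Nonempty := Finset.nonempty_range_iff.2 hN.ne'
  have hsum : ∑ _i ∈ Finset.range N,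
      |(acceptProb D (H 0)).toReal - (acceptProb D (H N)).toReal| / N ≤
      ∑ i ∈ Finset.range N,
        |(acceptProb D (H i)).toReal - (acceptProb D (H (i + 1))).toReal| := by
    rw [Finset.sum_const, Finset.card_range, nsmul_eq_mul,
      mul_div_cancel₀ _ (by exact_mod_cast hN.ne' : (N : ℝ) ≠ 0)]
    exact abs_acceptProb_sub_le_sum_range D H N
  obtain ⟨i, hi, h⟩ := Finset.exists_le_of_sum_le hne hsum
  exact ⟨i, Finset.mem_range.1 hi, h⟩

variable {ι : Type} [Fintype ι] [DecidableEq ι]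
variable {R : Type} [CommRing R] [Fintype R]

/-- **The chain of hybrids from `A_{s,χ}^m` to `U^m`.** For generators `f₀ = 0, f₁, …, f_N` with
`f_N` a unit (for Ring-LWE: `f_i = e_{≤ i} = ∑_{j ≤ i} e_j`, `f_N = ∑_j e_j = 1`), the worst-case-`s`
decision advantage of any `m`-sample distinguisher is at most the sum of its gaps between
consecutive hybrids: `|Pr[D(A_{s,χ}^m)] − Pr[D(U^m)]| ≤ ∑_{i<N} |Pr[D((A^{fᵢ})^m)] − Pr[D((A^{fᵢ₊₁})^m)]|`
("Since `A⁰_{s,ψ} = A_{s,ψ}`, and `A^{m−1}_{s,ψ}` is [here: exactly] the uniform distribution, … there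
must exist an `i` …"). [cite: LyubashevskyPeikertRegev2013JACM, Lemma 5.14 (proof, p. 30) with Def. 5.7 and Lemma 5.13] -/
theorem distinguishingAdvantageOf_le_sum_hybridGaps (χ : PMF R) (s : ι → R) (m : ℕ)
    (D : Distinguisher ι R m) (f : ℕ → R) (hf0 : f 0 = 0) {N : ℕ} (hfN : IsUnit (f N)) :
    distinguishingAdvantageOf χ m D s ≤
      ∑ i ∈ Finset.range N, |(acceptProb D (hybridSamples χ s (f i) m)).toReal -
        (acceptProb D (hybridSamples χ s (f (i + 1)) m)).toReal| := by
  have h := abs_acceptProb_sub_le_sum_range D (fun i => hybridSamples χ s (f i) m) N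
  simp only [hf0, hybridSamples_zero, hybridSamples_of_isUnit χ s hfN] at h
  exact h

/-- … hence some consecutive pair of hybrids `(A^{fᵢ})^m`, `(A^{fᵢ₊₁})^m` is told apart with gap at
least `Adv/N` (the `i` handed to Lemma 5.9 / LS15 Lemma 4.18, where `fᵢ₊₁ = fᵢ + eᵢ₊₁`). [cite: LyubashevskyPeikertRegev2013JACM, Lemma 5.14 (p. 30)] -/
theorem exists_hybridGap_ge (χ : PMF R) (s : ι → R) (m : ℕ) (D : Distinguisher ι R m) (f : ℕ → R)
    (hf0 : f 0 = 0) {N : ℕ} (hN : 0 < N) (hfN : IsUnit (f N)) :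
    ∃ i < N, distinguishingAdvantageOf χ m D s / N ≤
      |(acceptProb D (hybridSamples χ s (f i) m)).toReal -
        (acceptProb D (hybridSamples χ s (f (i + 1)) m)).toReal| := by
  have h := exists_le_gap_of_chain D (fun i => hybridSamples χ s (f i) m) hN
  simp only [hf0, hybridSamples_zero, hybridSamples_of_isUnit χ s hfN] at h
  exact h

end Telescoping

end LPR13

end LWE

end Literature.Computability.Cryptography

end
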